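import Summits.BirchSwinnertonDyer.BirchSwinnertonDyer.Theses.LeadingTerm
import Summits.BirchSwinnertonDyer.BirchSwinnertonDyer.Theorems.LeadingTermPinchPrimeOrderEqRankOfSchneiderShaAt
import Literature.NumberTheory.EllipticCurves.PAdicBSD
import Literature.NumberTheory.EllipticCurves.IwasawaLeadingTerm
import Literature.NumberTheory.EllipticCurves.KatoRankBoundProofs
import Literature.NumberTheory.EllipticCurves.IwasawaSelmerDualProofs
import Literature.NumberTheory.EllipticCurves.SelmerInftyTorsionFiniteProofs
import Literature.NumberTheory.EllipticCurves.CanonicalPAdicHeightHolds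
import Literature.NumberTheory.EllipticCurves.CyclotomicIwasawaMainTheoremIrreducible

/-!
# BirchSwinnertonDyer / LeadingTerm — crux `PinchPrime` (stmt-BirchSwinnertonDyer-16218),
# line `SketchIdeator2`, stub `stub_schneiderSha_of_pinchAt_kato` (GLUE G13, v22): NECESSITY of
# the same-prime pair at THEOREM GRADE (Kato's divisibility instead of the order main conjecture)

Registered stub of the lead skeleton `Cruxes/PinchPrime/Lines/SketchIdeator2.lean` (v22, lead c5):
the POINTWISE CONVERSE of the landed G1 `stub_orderEqRankOfSchneiderShaAt`. For an elliptic curve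
`E/ℚ` (globally minimal `W`), a good ordinary prime `p ≥ 5` and a newform `f` of `E`: if
`ord_{T=0} L_p(f, α_p, T) = rank_ℤ E(ℚ)` (the `(W, p)`-instance of the crux) then the canonical
cyclotomic `p`-adic height is NON-DEGENERATE (`Reg_p(E, Dh) ≠ 0` for every canonical datum `Dh`,
Schneider's conjecture at `p`) AND `Ш(E/ℚ)[p^∞]` is finite — with NO irreducibility hypothesis on
`E[p]` and NO main conjecture: the two deep inputs, both HYPOTHESES and both PUBLISHED THEOREMS, are
* `kato_divisibility W p` (K. Kato, Astérisque 295 (2004), Thm. 17.4 (1)–(2): `X(E/ℚ_∞)` is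
  `Λ`-torsion and `char_Λ X ∣ p^n · L_p(E,T)` in `Λ[1/p]`), and
* `Schneider1985_order_charGenerator` (Perrin-Riou–Schneider as printed in Balakrishnan–Müller–
  Stein, Math. Comp. 85 (2016), Thm. 1.7: clause 1 `rank ≤ ord_{T=0} f_E`, clause 2
  `ord_{T=0} f_E = rank ↔ Reg_p ≠ 0 ∧ #Ш[p^∞] < ∞`).
The chain is `rank ≤ ord f_E ≤ ord g ≤ ord (ι g) = ord (p^n L_p) = ord L_p = rank` for the
generator `f_E` of `char X` (`charIdeal_isPrincipal_holds`) and Kato's `g ∈ char X`, whence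
`ord f_E = rank` and clause 2 applies. The cyclotomic datum `(κ, γ)`
(`exists_isCyclotomic_isTopGenerator_isCyclotomicVariable_holds`), the Iwasawa datum
(`nonempty_selmerDualData_holds`) and its finite generation (`module_finite_of_isCyclotomic`) are
tree theorems.

Why it is here (lead c5, line cycle 6). The refuter's content theorem
`Theorems/PinchPrime/Negative/ContentOfCrux.leadingTermPinchPrime_iff_schneiderSha_somewhere` takes
the main conjecture in ORDER form (`ord_T L_p = ord_T f_E` at every good ordinary `p ≥ 5`,
conjecture-strength at residually reducible `p`) as a hypothesis in BOTH directions. For the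
forward direction Kato's divisibility suffices, so — modulo published theorems only — every proof
of the crux proves, for EVERY elliptic `E/ℚ`, Schneider non-degeneracy and finiteness of
`Ш[p^∞]` at one and the same good ordinary `p ≥ 5`
(`schneiderSha_somewhere_of_PinchPrime_kato`): on analytic rank `1` non-CM this is the line's
residual (S″) minus `E[p]`-irreducibility, on analytic rank `≥ 2` the residual (J) minus
irreducibility (`samePrimeResidualMinus_of_PinchPrime_kato`). Together with the landed sufficiency
bridge G12/G1 (which needs irreducibility for BCS), the crux is pinned between (J, S″) and
(J⁻, S″⁻), the gap being `E[p]`-irreducibility at the witness prime (cofinite in `p`,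
`exists_forall_hasIrreducibleModPGaloisRep_of_lt`). At an irreducible prime the `(W,p)`-instance of
the crux is EQUIVALENT to the pair (`pinchAt_iff_schneiderSha_of_irreducible_kato`).
-/

noncomputable section

set_option linter.dupNamespace false

namespace Summit.BirchSwinnertonDyer.BirchSwinnertonDyer.Cruxes.PinchPrime.FirstLayerStability

open scoped MatrixGroups ModularForm
open CongruenceSubgroup Literature.NumberTheory.EllipticCurves
  Literature.NumberTheory.EllipticCurves.ModularForms
open Summit.BirchSwinnertonDyer.BirchSwinnertonDyer.Theses

/-- **Kato's divisibility in ORDER form for a generator of `char X`.** At an odd good ordinary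
prime, for the cyclotomic datum `(κ, γ)`, a finitely generated Iwasawa datum `D` with
`char_Λ X = (f_E)` and a newform `f` of `E`: `X` is `Λ`-torsion and
`ord_{T=0} f_E ≤ ord_{T=0} L_p(f, α_p, T)` — from `g ∈ char X = (f_E)`, `ι g = p^n · L_p`
(`kato_divisibility`, hypothesis): `ord f_E ≤ ord g ≤ ord (ι g) = ord L_p`.
[cite: Kato2004Asterisque, Thm. 17.4 (p. 273)] -/
theorem isTorsion_and_order_charGenerator_le_order_padicLFunction_of_kato
    (W : WeierstrassCurve ℚ) [W.IsElliptic] [W.IsGloballyMinimal] (p : ℕ) [Fact p.Prime]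
    {κ : ZpExtension ℚ p} {γ : Field.absoluteGaloisGroup ℚ} {N : ℕ} [NeZero N]
    {f : CuspForm (Gamma0 N) 2}
    (hkato : kato_divisibility W p (κ := κ) (γ := γ) (f := f))
    (hp : p ≠ 2) (hord : IsOrdinaryAt W p) (hκ : κ.IsCyclotomic) (hγ : κ.IsTopGenerator γ)
    (hγ' : IsCyclotomicVariable p γ) (hf : IsNewformOf W f)
    (D : W.SelmerDualData κ γ) (fE : IwasawaAlgebra p) (hfE : D.charIdeal = Ideal.span {fE}) :
    D.IsTorsion ∧ fE.order ≤ (padicLFunction f (unitRoot W p : ℚ_[p])).order := by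
  obtain ⟨htors, ⟨n, g, hg, hιg⟩, -⟩ := hkato hp hord hκ hγ hγ' hf D
  refine ⟨htors, ?_⟩
  -- `f_E ∣ g`
  rw [hfE] at hg
  obtain ⟨a, rfl⟩ := Ideal.mem_span_singleton'.mp hg
  -- `ord f_E ≤ ord (a * f_E)`
  have h1 : fE.order ≤ (a * fE).order :=
    le_trans (by simp) (PowerSeries.le_order_mul a fE)
  -- `ord g ≤ ord (ι g)` (coefficientwise `ℤ_p → ℚ_p`)
  have h2 : (a * fE).order ≤ (iwasawaToPowerSeries p (a * fE)).order :=
    PowerSeries.le_order_map _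
  -- `ord (ι g) = ord (p^n L_p) = ord L_p`
  have hpn : IsUnit (PowerSeries.C ((p : ℚ_[p]) ^ n)) := by
    refine IsUnit.map PowerSeries.C (IsUnit.mk0 _ (pow_ne_zero n ?_))
    exact_mod_cast (Fact.out : p.Prime).ne_zero
  have h3 : (iwasawaToPowerSeries p (a * fE)).order =
      (padicLFunction f (unitRoot W p : ℚ_[p])).order := by
    rw [hιg, PowerSeries.order_mul, PowerSeries.order_zero_of_unit hpn, zero_add]
  exact h3 ▸ h1.trans h2

/-- **At a pinch prime `ord_{T=0} f_E = rank`, for every Iwasawa datum** (modulo PRS and Kato's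
divisibility — hypotheses; no main conjecture, no irreducibility): if
`ord_{T=0} L_p(f, α_p, T) = rank_ℤ E(ℚ)` at a good ordinary `p ≥ 5` then for the cyclotomic datum
`(κ, γ)`, every finitely generated Iwasawa datum `D` and every generator `f_E` of `char X`, `X` is
torsion and `ord_{T=0} f_E = rank`: `rank ≤ ord f_E` (PRS clause 1, at the canonical height datum,
which exists: `exists_isCanonical_holds`) and `ord f_E ≤ ord L_p = rank` (Kato).
[cite: BalakrishnanMullerStein2015, Thm. 1.7] [cite: Kato2004Asterisque, Thm. 17.4 (p. 273)] -/
theorem isTorsion_and_order_charGenerator_eq_rank_of_pinchAt_kato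
    (hPRS : Schneider1985_order_charGenerator)
    (W : WeierstrassCurve ℚ) [W.IsElliptic] [W.IsGloballyMinimal] (p : ℕ) [Fact p.Prime]
    {κ : ZpExtension ℚ p} {γ : Field.absoluteGaloisGroup ℚ} {N : ℕ} [NeZero N]
    {f : CuspForm (Gamma0 N) 2}
    (hkato : kato_divisibility W p (κ := κ) (γ := γ) (f := f))
    (h5 : 5 ≤ p) (hord : IsOrdinaryAt W p) (hκ : κ.IsCyclotomic) (hγ : κ.IsTopGenerator γ)
    (hγ' : IsCyclotomicVariable p γ) (hf : IsNewformOf W f)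
    (horder : (padicLFunction f (unitRoot W p : ℚ_[p])).order = W.mordellWeilRank)
    (D : W.SelmerDualData κ γ) [Module.Finite (IwasawaAlgebra p) D.X]
    (fE : IwasawaAlgebra p) (hfE : D.charIdeal = Ideal.span {fE}) :
    D.IsTorsion ∧ fE.order = W.mordellWeilRank := by
  obtain ⟨hX, hle⟩ := isTorsion_and_order_charGenerator_le_order_padicLFunction_of_kato W p hkato
    (by omega) hord hκ hγ hγ' hf D fE hfE
  obtain ⟨Dh, hDh⟩ := WeierstrassCurve.exists_isCanonical_holds W p h5 hord.1 hord.2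
  have hge : (W.mordellWeilRank : ℕ∞) ≤ fE.order :=
    (hPRS W p h5 hord.1 hord.2 κ γ hκ hγ hγ' D hX fE hfE Dh hDh).1
  rw [horder] at hle
  exact ⟨hX, le_antisymm hle hge⟩

/-- **Stub G13 `stub_schneiderSha_of_pinchAt_kato` (crux `PinchPrime`, line `SketchIdeator2`,
v22): the `(W, p)`-instance of the crux FORCES Schneider non-degeneracy and finiteness of
`Ш(E/ℚ)[p^∞]` at that prime**, modulo Perrin-Riou–Schneider and Kato's divisibility at `(W, p, f)`
for all cyclotomic data (hypotheses; both published theorems). For `E/ℚ` elliptic (globally minimal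
`W`), `p ≥ 5` good ordinary, `f` a newform of `E` with `ord_{T=0} L_p(f, α_p, T) = rank_ℤ E(ℚ)`:
every canonical height datum `Dh` has `Reg_p(E, Dh) ≠ 0`, and `Ш(E/ℚ)[p^∞]` is finite — take the
cyclotomic datum, the Iwasawa datum `D` (finitely generated) and a generator `f_E` of `char X`
(`charIdeal_isPrincipal_holds`); `ord f_E = rank` by
`isTorsion_and_order_charGenerator_eq_rank_of_pinchAt_kato`, and PRS clause 2 converts.
[cite: BalakrishnanMullerStein2015, Thm. 1.7] [cite: Kato2004Asterisque, Thm. 17.4 (p. 273)] -/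
theorem stub_schneiderSha_of_pinchAt_kato :
    Schneider1985_order_charGenerator →
    ∀ (W : WeierstrassCurve ℚ) [W.IsElliptic] [W.IsGloballyMinimal] (p : ℕ) [Fact p.Prime]
      {N : ℕ} [NeZero N] (f : CuspForm (Gamma0 N) 2),
      (∀ (κ : ZpExtension ℚ p) (γ : Field.absoluteGaloisGroup ℚ),
        kato_divisibility W p (κ := κ) (γ := γ) (f := f)) →
      5 ≤ p → IsOrdinaryAt W p → IsNewformOf W f →
      (padicLFunction f (unitRoot W p : ℚ_[p])).order = W.mordellWeilRank →
      ∀ (Dh : WeierstrassCurve.PAdicHeightData W p), Dh.IsCanonical →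
        WeierstrassCurve.SchneiderConjecture Dh ∧
          Finite (AddCommGroup.primaryComponent W.sha p) := by
  intro hPRS W _ _ p _ N _ f hkato h5 hord hf horder Dh hDh
  obtain ⟨κ, hκ, γ, hγ, hγ'⟩ := exists_isCyclotomic_isTopGenerator_isCyclotomicVariable_holds p
  obtain ⟨D⟩ := W.nonempty_selmerDualData_holds κ γ hγ
  haveI : Module.Finite (IwasawaAlgebra p) D.X := D.module_finite_of_isCyclotomic W κ hκ hγ
  obtain ⟨fE, hfE⟩ : ∃ fE : IwasawaAlgebra p, D.charIdeal = Ideal.span {fE} := by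
    have hP : (D.charIdeal).IsPrincipal := charIdeal_isPrincipal_holds p D.X
    exact ⟨hP.generator, (Ideal.span_singleton_generator D.charIdeal).symm⟩
  obtain ⟨hX, hfEord⟩ := isTorsion_and_order_charGenerator_eq_rank_of_pinchAt_kato hPRS W p
    (hkato κ γ) h5 hord hκ hγ hγ' hf horder D fE hfE
  exact (hPRS W p h5 hord.1 hord.2 κ γ hκ hγ hγ' D hX fE hfE Dh hDh).2.1.mp hfEord

/-- **The crux forces the same-prime pair for every curve, at theorem grade** (modulo PRS and
Kato's divisibility for all `(W, p, κ, γ, f)` — hypotheses, both published theorems; no main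
conjecture, no modularity, no irreducibility): `LeadingTerm.PinchPrime` implies that every
elliptic `E/ℚ` (globally minimal `W`) has a good ordinary `p ≥ 5` at which `Ш(E/ℚ)[p^∞]` is
finite and EVERY canonical cyclotomic height datum is non-degenerate (and one exists — the crux
carries it). Compare `Negative/ContentOfCrux.schneiderSha_somewhere_of_leadingTermPinchPrime`
(same conclusion modulo the ORDER main conjecture and an Iwasawa-datum hypothesis).
[cite: BalakrishnanMullerStein2015, Thm. 1.7] [cite: Kato2004Asterisque, Thm. 17.4 (p. 273)] -/
theorem schneiderSha_somewhere_of_PinchPrime_kato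
    (hPRS : Schneider1985_order_charGenerator)
    (hkato : ∀ (W : WeierstrassCurve ℚ) [W.IsElliptic] [W.IsGloballyMinimal] (p : ℕ) [Fact p.Prime]
      (κ : ZpExtension ℚ p) (γ : Field.absoluteGaloisGroup ℚ) {N : ℕ} [NeZero N]
      (f : CuspForm (Gamma0 N) 2), kato_divisibility W p (κ := κ) (γ := γ) (f := f))
    (hS : LeadingTerm.PinchPrime)
    (W : WeierstrassCurve ℚ) [W.IsElliptic] [W.IsGloballyMinimal] :
    ∃ (p : ℕ) (_ : Fact p.Prime), 5 ≤ p ∧ IsOrdinaryAt W p ∧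
      Finite (AddCommGroup.primaryComponent W.sha p) ∧
      (∃ D : WeierstrassCurve.PAdicHeightData W p,
        D.IsCanonical ∧ WeierstrassCurve.SchneiderConjecture D) ∧
      ∀ Dh : WeierstrassCurve.PAdicHeightData W p, Dh.IsCanonical →
        WeierstrassCurve.SchneiderConjecture Dh := by
  obtain ⟨p, hp, h5, hord, D, hD, N, hN, f, hf, horder⟩ := hS W
  have key := stub_schneiderSha_of_pinchAt_kato hPRS W p f (fun κ γ ↦ hkato W p κ γ f) h5 hord hf
    horder
  exact ⟨p, hp, h5, hord, (key D hD).2, ⟨D, hD, (key D hD).1⟩, fun Dh hDh ↦ (key Dh hDh).1⟩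

/-- **The line's same-prime residual MINUS irreducibility is NECESSARY for the crux** (modulo PRS
and Kato's divisibility — hypotheses, published theorems): `LeadingTerm.PinchPrime` implies
(J⁻) every curve of analytic rank `≥ 2` has a good ordinary `p ≥ 5` with `Ш(E/ℚ)[p^∞]` finite and
every canonical datum non-degenerate, and (S″⁻) every non-CM curve of analytic rank `1` has a good
ordinary `p ≥ 5` with every canonical datum non-degenerate (`h_p(P) ≠ 0`). The landed sufficiency
bridge G12 `stub_pinchAt_of_samePrime` asks the same with `E[p]` irreducible at the witness (J, S″):
the crux sits between (J, S″) and (J⁻, S″⁻). [cite: BalakrishnanMullerStein2015, Thm. 1.7]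
[cite: Kato2004Asterisque, Thm. 17.4 (p. 273)] [cite: MazurSteinTate2006, Conj. 1.1] -/
theorem samePrimeResidualMinus_of_PinchPrime_kato
    (hPRS : Schneider1985_order_charGenerator)
    (hkato : ∀ (W : WeierstrassCurve ℚ) [W.IsElliptic] [W.IsGloballyMinimal] (p : ℕ) [Fact p.Prime]
      (κ : ZpExtension ℚ p) (γ : Field.absoluteGaloisGroup ℚ) {N : ℕ} [NeZero N]
      (f : CuspForm (Gamma0 N) 2), kato_divisibility W p (κ := κ) (γ := γ) (f := f))
    (hS : LeadingTerm.PinchPrime) :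
    (∀ (W : WeierstrassCurve ℚ) [W.IsElliptic] [W.IsGloballyMinimal], 2 ≤ W.analyticRank →
      ∃ (p : ℕ) (_ : Fact p.Prime), 5 ≤ p ∧ IsOrdinaryAt W p ∧
        Finite (AddCommGroup.primaryComponent W.sha p) ∧
        ∀ Dh : WeierstrassCurve.PAdicHeightData W p, Dh.IsCanonical →
          WeierstrassCurve.SchneiderConjecture Dh) ∧
    (∀ (W : WeierstrassCurve ℚ) [W.IsElliptic] [W.IsGloballyMinimal], W.analyticRank = 1 →
      ¬ W.HasCM →
      ∃ (p : ℕ) (_ : Fact p.Prime), 5 ≤ p ∧ IsOrdinaryAt W p ∧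
        ∀ Dh : WeierstrassCurve.PAdicHeightData W p, Dh.IsCanonical →
          WeierstrassCurve.SchneiderConjecture Dh) := by
  refine ⟨fun W _ _ _ ↦ ?_, fun W _ _ _ _ ↦ ?_⟩
  · obtain ⟨p, hp, h5, hord, hsha, -, hSch⟩ := schneiderSha_somewhere_of_PinchPrime_kato hPRS hkato hS W
    exact ⟨p, hp, h5, hord, hsha, hSch⟩
  · obtain ⟨p, hp, h5, hord, -, -, hSch⟩ := schneiderSha_somewhere_of_PinchPrime_kato hPRS hkato hS W
    exact ⟨p, hp, h5, hord, hSch⟩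

/-- **At an admissible irreducible prime the `(W, p)`-instance of the crux is EQUIVALENT to the
same-prime pair** (modulo PRS, BCS and Kato's divisibility at `(W, p, f)` — hypotheses, all
published theorems): for `p ≥ 5` good ordinary with `E[p]` irreducible and `f` a newform of `E`,
`ord_{T=0} L_p(f, α_p, T) = rank_ℤ E(ℚ)` iff `Ш(E/ℚ)[p^∞]` is finite and every canonical height
datum is non-degenerate (`→` is G13, Kato + PRS; `←` is the landed G1
`stub_orderEqRankOfSchneiderShaAt`, BCS + PRS, at the canonical datum of `exists_isCanonical_holds`).
[cite: BalakrishnanMullerStein2015, Thm. 1.7] [cite: BurungaleCastellaSkinner2025, Thm. 1.1.2 (a)]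
[cite: Kato2004Asterisque, Thm. 17.4 (p. 273)] -/
theorem pinchAt_iff_schneiderSha_of_irreducible_kato
    (hPRS : Schneider1985_order_charGenerator)
    (hBCS : burungale_castella_skinner_charIdeal_eq_padicLFunction)
    (W : WeierstrassCurve ℚ) [W.IsElliptic] [W.IsGloballyMinimal] (p : ℕ) [Fact p.Prime]
    {N : ℕ} [NeZero N] (f : CuspForm (Gamma0 N) 2)
    (hkato : ∀ (κ : ZpExtension ℚ p) (γ : Field.absoluteGaloisGroup ℚ),
      kato_divisibility W p (κ := κ) (γ := γ) (f := f))
    (h5 : 5 ≤ p) (hord : IsOrdinaryAt W p) (hirr : W.HasIrreducibleModPGaloisRep p)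
    (hf : IsNewformOf W f) :
    (padicLFunction f (unitRoot W p : ℚ_[p])).order = W.mordellWeilRank ↔
      (Finite (AddCommGroup.primaryComponent W.sha p) ∧
        ∀ Dh : WeierstrassCurve.PAdicHeightData W p, Dh.IsCanonical →
          WeierstrassCurve.SchneiderConjecture Dh) := by
  constructor
  · intro horder
    obtain ⟨Dh₀, hDh₀⟩ := WeierstrassCurve.exists_isCanonical_holds W p h5 hord.1 hord.2
    have key := stub_schneiderSha_of_pinchAt_kato hPRS W p f hkato h5 hord hf horder
    exact ⟨(key Dh₀ hDh₀).2, fun Dh hDh ↦ (key Dh hDh).1⟩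
  · rintro ⟨hsha, hSch⟩
    obtain ⟨Dh, hDh⟩ := WeierstrassCurve.exists_isCanonical_holds W p h5 hord.1 hord.2
    exact stub_orderEqRankOfSchneiderShaAt hPRS hBCS W p h5 hord hirr hsha Dh hDh (hSch Dh hDh) f hf

end Summit.BirchSwinnertonDyer.BirchSwinnertonDyer.Cruxes.PinchPrime.FirstLayerStability

end
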